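import Mathlib
import HarnessLib
import Summits.HubbardSuperconductivity.HubbardSuperconductivity.Theorems.KLProgrammeH10TwoPointLimitPerturbedCountCalculus
import Summits.HubbardSuperconductivity.HubbardSuperconductivity.Theorems.KLProgrammeH10TwoPointLimitPerturbedFermiRadiusSmooth

/-!
# Route `KLProgramme` — crux K1 `H10TwoPointLimit` (stmt-HubbardSuperconductivity-19938):
# the band coordinates of the PERTURBED curve at the shifted level (the mechanism of PORT-NOTE architecture (β))

For a root selection `u` of `{ε₀ + δ = μ}` with `|δ| ≤ κ₀`, `‖Dδ‖_∞ ≤ κ₁ < Dt_min` on the closed square, at every angle `θ` with shifted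
level `ν(θ) = μ - δ(u θ·dir θ) ∈ [a, b]`: `XE u θ = bandX ν θ`, `YE u θ = bandY ν θ` EXACTLY (`XE_eq_bandX_shifted`), and the velocities
differ from the free ones at that level by `|VXE u θ - bandVX ν θ|, |VYE u θ - bandVY ν θ| ≤ κ₁ (π√2 + 2 s_max)/(Dt_min - κ₁)`
(`abs_VXE_sub_bandVX_le`; from BGM (2.40) first order, `abs_deriv_sub_bandFermiRadiusDeriv_le`, with `u ≤ π√2` and `|u_ν'| ≤ 2 s_max`); hence
`|VXE|, |VYE| ≤ s_max + κ₁ (π√2 + 2 s_max)/(Dt_min - κ₁)`. So every free-band lemma about `(bandX, bandY, bandVX, bandVY)` at ONE level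
applies to a perturbed leg at its shifted level up to an `O(κ₁)` velocity error — the slack the free geometric lemmas' fixed tolerances
absorb (`…PerturbedCountCover.lean`). Everything is PROVED; no definitions. References: BGM 2006 §2.4 Lemma 2.1 (2.40), App. A2–A3
[cite: BenfattoGiulianiMastropietro2006].
-/

noncomputable section

namespace Summit.HubbardSuperconductivity.HubbardSuperconductivity.Theorems.PerturbedFermiCurve

set_option linter.dupNamespace false -- summit = problem name (single-conjunct summit), D-0017

open Real Set
open Literature.MathematicalPhysics.QuantumLattice Literature.MathematicalPhysics.QuantumLattice.BandSectorCounting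

/-! ## §0 Two small sup-norm facts -/

/-- The sup norm of a pair: `‖(v₀, v₁)‖_∞ ≤ M` if `|v₀|, |v₁| ≤ M`. [folklore] -/
theorem norm_vec2_le {v₀ v₁ M : ℝ} (hM : 0 ≤ M) (h₀ : |v₀| ≤ M) (h₁ : |v₁| ≤ M) : ‖![v₀, v₁]‖ ≤ M := by
  refine (pi_norm_le_iff_of_nonneg hM).2 fun i => ?_
  fin_cases i <;> simpa [Real.norm_eq_abs]

/-- `|Dδ(k)[(v₀, v₁)]| ≤ κ₁ M` when `‖Dδ(k)‖ ≤ κ₁` and `|v₀|, |v₁| ≤ M`. [folklore] -/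
theorem abs_fderiv_vec2_le {δ : (Fin 2 → ℝ) → ℝ} {k : Fin 2 → ℝ} {κ₁ v₀ v₁ M : ℝ} (hκ : ‖fderiv ℝ δ k‖ ≤ κ₁) (hM : 0 ≤ M)
    (h₀ : |v₀| ≤ M) (h₁ : |v₁| ≤ M) : |fderiv ℝ δ k ![v₀, v₁]| ≤ κ₁ * M := by
  rw [← Real.norm_eq_abs]
  refine ((fderiv ℝ δ k).le_opNorm _).trans ?_
  exact mul_le_mul hκ (norm_vec2_le hM h₀ h₁) (norm_nonneg _) ((norm_nonneg _).trans hκ)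

/-! ## §2 Band coordinates of the perturbed curve at the shifted level -/

/-- The band Fermi radius is at most `π√2` (the curve lies in the square; `‖dir θ‖_∞ ≥ √2/2`). [folklore] -/
theorem bandFermiRadius_le_pi_mul_sqrt_two {ν : ℝ} (hν₁ : -4 < ν) (hν₂ : ν < 0) (θ : ℝ) :
    bandFermiRadius ν θ ≤ π * Real.sqrt 2 := by
  have hlt := bandFermiRadius_lt_exit hν₁ hν₂ θ
  have hd := sqrt_two_div_two_le_norm_dir θ
  have hn := norm_dir_pos θ
  have h2 : 0 < Real.sqrt 2 := Real.sqrt_pos.2 (by norm_num)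
  have hsq : Real.sqrt 2 * Real.sqrt 2 = 2 := Real.mul_self_sqrt (by norm_num)
  have : π / ‖dir θ‖ ≤ π * Real.sqrt 2 := by
    rw [div_le_iff₀ hn]
    have : π * 1 ≤ π * (Real.sqrt 2 * ‖dir θ‖) := by
      refine mul_le_mul_of_nonneg_left ?_ Real.pi_pos.le
      nlinarith
    linarith
  linarith

/-- `|u_ν'(θ)| ≤ 2 s_max` on the level range (`u' = X' cos θ + Y' sin θ`). [folklore] -/
theorem abs_bandFermiRadiusDeriv_le {a b : ℝ} (B : BandBounds a b) {ν : ℝ} (hν : ν ∈ Icc a b) (θ : ℝ) :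
    |bandFermiRadiusDeriv ν θ| ≤ 2 * B.smax := by
  have hx := B.abs_VX_le ν hν θ
  have hy := B.abs_VY_le ν hν θ
  have hid : bandFermiRadiusDeriv ν θ = bandVX ν θ * Real.cos θ + bandVY ν θ * Real.sin θ := by
    simp only [bandVX, bandVY]
    have := Real.cos_sq_add_sin_sq θ
    linear_combination -(bandFermiRadiusDeriv ν θ) * this
  rw [hid]
  have hc := Real.abs_cos_le_one θ; have hs := Real.abs_sin_le_one θ
  calc |bandVX ν θ * Real.cos θ + bandVY ν θ * Real.sin θ|
        ≤ |bandVX ν θ * Real.cos θ| + |bandVY ν θ * Real.sin θ| := abs_add_le _ _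
    _ = |bandVX ν θ| * |Real.cos θ| + |bandVY ν θ| * |Real.sin θ| := by rw [abs_mul, abs_mul]
    _ ≤ B.smax * 1 + B.smax * 1 := add_le_add (mul_le_mul hx hc (abs_nonneg _) B.smax_pos.le)
        (mul_le_mul hy hs (abs_nonneg _) B.smax_pos.le)
    _ = 2 * B.smax := by ring

section Shifted

variable {a b : ℝ} (B : BandBounds a b) {δ : (Fin 2 → ℝ) → ℝ} {n : WithTop ℕ∞} (hδs : ContDiff ℝ n δ) (hn : n ≠ 0)
  {κ₀ κ₁ μ : ℝ} (hδ : ∀ k : Fin 2 → ℝ, (∀ i, |k i| ≤ π) → |δ k| ≤ κ₀) (hlo : a ≤ μ - κ₀) (hhi : μ + κ₀ ≤ b)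
  (hκ : ∀ k : Fin 2 → ℝ, (∀ i, |k i| ≤ π) → ‖fderiv ℝ δ k‖ ≤ κ₁) (hκ₁ : κ₁ < B.Dtmin)
  {u : ℝ → ℝ} (hu : ∀ θ, IsBandFermiRadius (μ - δ (u θ • dir θ)) θ (u θ))
include B hδ hlo hhi hu

/-- **The perturbed curve point IS the free band point of the shifted level**: `X_E(θ) = bandX ν θ`, `Y_E(θ) = bandY ν θ`,
`ν = μ - δ(u θ·dir θ)`. [cite: BenfattoGiulianiMastropietro2006, §2.4 Lemma 2.1] -/
theorem XE_eq_bandX_shifted (θ : ℝ) :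
    XE u θ = bandX (μ - δ (u θ • dir θ)) θ ∧ YE u θ = bandY (μ - δ (u θ • dir θ)) θ := by
  have h := eq_bandFermiRadius_of_shifted B hδ hlo hhi (hu θ)
  exact ⟨congrArg (· * Real.cos θ) h, congrArg (· * Real.sin θ) h⟩

/-- `u(θ) ≤ π√2`. [folklore] -/
theorem root_le_pi_mul_sqrt_two (θ : ℝ) : u θ ≤ π * Real.sqrt 2 := by
  have hm := shiftedLevel_mem_Icc (hu θ) hδ hlo hhi
  rw [eq_bandFermiRadius_of_shifted B hδ hlo hhi (hu θ)]
  exact bandFermiRadius_le_pi_mul_sqrt_two (B.ha.trans_le hm.1) (hm.2.trans_lt B.hb) θ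

include hδs hn hκ hκ₁

/-- **First-order closeness of the radial slope, uniform form**: `|u'(θ) - u_ν'(θ)| ≤ κ₁ (π√2 + 2 s_max)/(Dt_min - κ₁)` at the shifted level.
[cite: BenfattoGiulianiMastropietro2006, §2.4 Lemma 2.1 (2.40)] -/
theorem abs_deriv_sub_bandFermiRadiusDeriv_le_uniform (θ : ℝ) :
    |deriv u θ - bandFermiRadiusDeriv (μ - δ (u θ • dir θ)) θ| ≤ κ₁ * (π * Real.sqrt 2 + 2 * B.smax) / (B.Dtmin - κ₁) := by
  have h := abs_deriv_sub_bandFermiRadiusDeriv_le B hδs hn hδ hlo hhi hκ hκ₁ hu θ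
  have hm := shiftedLevel_mem_Icc (hu θ) hδ hlo hhi
  have hu1 := root_le_pi_mul_sqrt_two B hδ hlo hhi hu θ
  have hu2 := abs_bandFermiRadiusDeriv_le B hm θ
  have hκ₁0 : 0 ≤ κ₁ := le_trans (norm_nonneg _) (hκ _ (abs_apply_le_pi_of_isBandFermiRadius (hu θ)))
  have hden : 0 < B.Dtmin - κ₁ := sub_pos.2 hκ₁
  refine h.trans (div_le_div_of_nonneg_right (mul_le_mul_of_nonneg_left (by linarith) hκ₁0) hden.le)

/-- **The perturbed velocities are within `O(κ₁)` of the free velocities at the shifted level**: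
`|X_E'(θ) - bandVX ν θ| ≤ κ₁ (π√2 + 2 s_max)/(Dt_min - κ₁)` and the same for `Y`. [cite: BenfattoGiulianiMastropietro2006, §2.4 Lemma 2.1 (2.40)] -/
theorem abs_VXE_sub_bandVX_le (θ : ℝ) :
    |VXE u θ - bandVX (μ - δ (u θ • dir θ)) θ| ≤ κ₁ * (π * Real.sqrt 2 + 2 * B.smax) / (B.Dtmin - κ₁) ∧
      |VYE u θ - bandVY (μ - δ (u θ • dir θ)) θ| ≤ κ₁ * (π * Real.sqrt 2 + 2 * B.smax) / (B.Dtmin - κ₁) := by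
  have h := abs_deriv_sub_bandFermiRadiusDeriv_le_uniform B hδs hn hδ hlo hhi hκ hκ₁ hu θ
  have hr := eq_bandFermiRadius_of_shifted B hδ hlo hhi (hu θ)
  have hx : VXE u θ - bandVX (μ - δ (u θ • dir θ)) θ =
      (deriv u θ - bandFermiRadiusDeriv (μ - δ (u θ • dir θ)) θ) * Real.cos θ := by
    rw [VXE, bandVX, ← hr]; ring
  have hy : VYE u θ - bandVY (μ - δ (u θ • dir θ)) θ =
      (deriv u θ - bandFermiRadiusDeriv (μ - δ (u θ • dir θ)) θ) * Real.sin θ := by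
    rw [VYE, bandVY, ← hr]; ring
  rw [hx, hy, abs_mul, abs_mul]
  exact ⟨(mul_le_of_le_one_right (abs_nonneg _) (Real.abs_cos_le_one θ)).trans h,
    (mul_le_of_le_one_right (abs_nonneg _) (Real.abs_sin_le_one θ)).trans h⟩

/-- **Speed bound on the perturbed curve**: `|X_E'|, |Y_E'| ≤ s_max + κ₁ (π√2 + 2 s_max)/(Dt_min - κ₁)`. [folklore] -/
theorem abs_VXE_le (θ : ℝ) :
    |VXE u θ| ≤ B.smax + κ₁ * (π * Real.sqrt 2 + 2 * B.smax) / (B.Dtmin - κ₁) ∧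
      |VYE u θ| ≤ B.smax + κ₁ * (π * Real.sqrt 2 + 2 * B.smax) / (B.Dtmin - κ₁) := by
  obtain ⟨hx, hy⟩ := abs_VXE_sub_bandVX_le B hδs hn hδ hlo hhi hκ hκ₁ hu θ
  have hm := shiftedLevel_mem_Icc (hu θ) hδ hlo hhi
  have h1 := B.abs_VX_le _ hm θ
  have h2 := B.abs_VY_le _ hm θ
  constructor
  · calc |VXE u θ| = |(VXE u θ - bandVX (μ - δ (u θ • dir θ)) θ) + bandVX (μ - δ (u θ • dir θ)) θ| := by ring_nf
      _ ≤ |VXE u θ - bandVX (μ - δ (u θ • dir θ)) θ| + |bandVX (μ - δ (u θ • dir θ)) θ| := abs_add_le _ _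
      _ ≤ _ := by linarith
  · calc |VYE u θ| = |(VYE u θ - bandVY (μ - δ (u θ • dir θ)) θ) + bandVY (μ - δ (u θ • dir θ)) θ| := by ring_nf
      _ ≤ |VYE u θ - bandVY (μ - δ (u θ • dir θ)) θ| + |bandVY (μ - δ (u θ • dir θ)) θ| := abs_add_le _ _
      _ ≤ _ := by linarith

/-- `∂₃ h^E` exists at every point (the root selection is differentiable everywhere, `δ ∈ Cⁿ`). [folklore] -/
theorem hasDerivAt_hfunE_three' (P : ℝ × ℝ) (θ₂ θ₃ : ℝ) :
    HasDerivAt (fun x => hfunE δ u μ P θ₂ x) (h3E δ u P θ₂ θ₃) θ₃ :=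
  hasDerivAt_hfunE_three μ P θ₂ (differentiable_of_isRoot B hδs hn hδ hlo hhi hκ hκ₁ hu θ₃)
    ((hδs.differentiable hn) _)

end Shifted

end Summit.HubbardSuperconductivity.HubbardSuperconductivity.Theorems.PerturbedFermiCurve

end
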